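import Summits.KontsevichZagierPeriods.KontsevichZagierPeriods.Theorems.LinRedNormalFormHoffmanIndependenceTruncatedSplit
import Summits.KontsevichZagierPeriods.KontsevichZagierPeriods.Theorems.LinRedNormalFormHoffmanIndependenceRungFour
import Summits.KontsevichZagierPeriods.KontsevichZagierPeriods.Theorems.LinRedNormalFormHoffmanIndependenceTruncation
import Summits.KontsevichZagierPeriods.KontsevichZagierPeriods.Theorems.LinRedNormalFormHoffmanIndependenceTruncationFinrank
import Summits.KontsevichZagierPeriods.KontsevichZagierPeriods.Theorems.LinRedNormalFormHoffmanIndependenceTruncationFive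

/-!
# Crux `HoffmanIndependence` (stmt-KontsevichZagierPeriods-15045), line `weight_split` —
# joint rungs 4 and 5 of the crux in classical numbers, and the dimension counts they equal

Corollaries assembling the cycle-2 files (`…TruncatedSplit`, `…RungFour`, `…Truncation`,
`…TruncationFinrank`, `…TruncationFive`):

* `truncation_four_iff_zeta_three` — the real Hoffman values of weight `≤ 4`
  (`1, ζ(2), ζ(3), ζ(2,2)`) are `ℚ`-independent iff `ζ(3) ∉ ℚ + ℚπ² + ℚπ⁴`;
* `linearIndependent_classicalFive_iff` — `1, π², ζ(3), π⁴, ζ(5), π²ζ(3)` are `ℚ`-independent iff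
  the Hoffman spans of weights `≤ 5` form a direct sum and `ζ(5) ∉ ℚ·ζ(2)ζ(3)`;
* `sum_zagierDim_le_finrank_iff_zeta_three` / `…_five_iff` — the same two rungs as the dimension
  counts `4 ≤ dim_ℚ (⨆_{k ≤ 4} hoffmanSpan k)` and `6 ≤ dim_ℚ (⨆_{k ≤ 5} hoffmanSpan k)`
  (`truncation_iff_sum_zagierDim_le_finrank`; `d_0 + ⋯ + d_4 = 4`, `d_0 + ⋯ + d_5 = 6`), which is
  the form the numerical LLL/PSLQ searches attached to the item test.

Nothing here closes the item; no new definitions. [cite: Zagier1994, §9]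
-/

noncomputable section

namespace Summit.KontsevichZagierPeriods.LinRedNormalForm.HoffmanIndependence

open Literature.NumberTheory.Transcendental MZV
open Summit.KontsevichZagierPeriods.KontsevichZagierPeriods.Theses.LinRedNormalForm (HoffmanIndependence)

/-- **Joint rung 4, typed: truncation 4 ⟺ `ζ(3) ∉ ℚ + ℚπ² + ℚπ⁴`** (the values of weight `≤ 4`
are `1, ζ(2), ζ(3), ζ(2,2) = π⁴/120`; slices `≤ 4` are theorems, so the truncation is its grading
rung, `weightGrading_initial_four_iff_zeta_three`). [cite: Zagier1994, §9] -/
theorem truncation_four_iff_zeta_three :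
    LinearIndependent ℚ
        (fun u : {u : List ℕ // IsHoffman u ∧ weight u ≤ 4} => multipleZeta u.1) ↔
      ∀ a b c : ℚ, multipleZeta [3] ≠ a + b * Real.pi ^ 2 + c * Real.pi ^ 4 := by
  rw [truncation_iff_initial_of_le_four le_rfl, weightGrading_initial_four_iff_zeta_three]

/-- **Joint rung 5 in classical coordinates**: `1, π², ζ(3), π⁴, ζ(5), π²ζ(3)` are `ℚ`-linearly
independent iff the Hoffman spans of weights `≤ 5` form a direct sum and `ζ(5) ∉ ℚ·ζ(2)ζ(3)`
(`truncation_five_iff` ∘ `truncation_five_iff_initial_and_slice`). [cite: Zagier1994, §9] -/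
theorem linearIndependent_classicalFive_iff :
    LinearIndependent ℚ ![(1 : ℝ), Real.pi ^ 2, multipleZeta [3], Real.pi ^ 4, multipleZeta [5],
        Real.pi ^ 2 * multipleZeta [3]] ↔
      iSupIndep (fun n : {n : ℕ // n ≤ 5} => hoffmanSpan n.1) ∧
        ∀ q : ℚ, multipleZeta [5] ≠ q * (multipleZeta [2] * multipleZeta [3]) := by
  rw [← truncation_five_iff, truncation_five_iff_initial_and_slice]

/-- **Joint rung 4 as a dimension count**: `ζ(3) ∉ ℚ + ℚπ² + ℚπ⁴` iff the filtered Hoffman span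
`⨆_{k ≤ 4} hoffmanSpan k = ℚ + ℚπ² + ℚζ(3) + ℚπ⁴` has dimension `≥ 4 = d_0 + ⋯ + d_4`.
[cite: Zagier1994, §9] -/
theorem sum_zagierDim_le_finrank_four_iff_zeta_three :
    4 ≤ Module.finrank ℚ ↥(⨆ k ∈ Finset.range 5, hoffmanSpan k) ↔
      ∀ a b c : ℚ, multipleZeta [3] ≠ a + b * Real.pi ^ 2 + c * Real.pi ^ 4 := by
  have h := (truncation_iff_sum_zagierDim_le_finrank 4).symm.trans truncation_four_iff_zeta_three
  have hs : ∑ k ∈ Finset.range (4 + 1), zagierDim k = 4 := by decide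
  rw [hs] at h
  exact h

/-- **Joint rung 5 as a dimension count**: `1, π², ζ(3), π⁴, ζ(5), π²ζ(3)` are independent iff the
filtered Hoffman span `⨆_{k ≤ 5} hoffmanSpan k` has dimension `≥ 6 = d_0 + ⋯ + d_5` — the statement
the item's numerical relation searches probe (no integer relation among the six numbers with small
coefficients). [cite: Zagier1994, §9] -/
theorem sum_zagierDim_le_finrank_five_iff :
    6 ≤ Module.finrank ℚ ↥(⨆ k ∈ Finset.range 6, hoffmanSpan k) ↔
      LinearIndependent ℚ ![(1 : ℝ), Real.pi ^ 2, multipleZeta [3], Real.pi ^ 4, multipleZeta [5],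
        Real.pi ^ 2 * multipleZeta [3]] := by
  have h := (truncation_iff_sum_zagierDim_le_finrank 5).symm.trans truncation_five_iff
  have hs : ∑ k ∈ Finset.range (5 + 1), zagierDim k = 6 := by decide
  rw [hs] at h
  exact h

/-- **The crux through weight 5, one statement**: `HoffmanIndependence` implies that
`1, π², ζ(3), π⁴, ζ(5), π²ζ(3)` are `ℚ`-linearly independent (its truncation at weight `5`); this
single consequence already contains `ζ(3) ∉ ℚ + ℚπ² + ℚπ⁴` and `ζ(5) ∉ ℚ + ℚπ² + ℚζ(3) + ℚπ⁴ + ℚπ²ζ(3)`,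
both open. [cite: Zagier1994, §9] -/
theorem linearIndependent_classicalFive_of_hoffmanIndependence (h : HoffmanIndependence) :
    LinearIndependent ℚ ![(1 : ℝ), Real.pi ^ 2, multipleZeta [3], Real.pi ^ 4, multipleZeta [5],
        Real.pi ^ 2 * multipleZeta [3]] :=
  truncation_five_iff.1 (truncation_of_hoffmanIndependence h 5)

end Summit.KontsevichZagierPeriods.LinRedNormalForm.HoffmanIndependence
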